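import Literature.AnabelianGeometry.SemiGraphs.TemperedReconstructionCor39UpToTwist
import Literature.AnabelianGeometry.SemiGraphs.TemperedReconstructionCor39UpToTwistAssembly
import Literature.AnabelianGeometry.SemiGraphs.TemperedReconstructionBaseUniquenessProofs
import HarnessLib

/-!
# Corollary 3.9 up to twist, modulo Theorem 3.7 (iii) alone (proof-only)

Mochizuki, *Semi-graphs of anabelioids*, Publ. RIMS **42** (2006), §3, Cor. 3.9, proof pp. 42–43
[cite: MochizukiSemiAnbd2006, Cor 3.9 pp.42-43].  The named twin `Cor39CompatUpToTwist`
(`TemperedReconstructionCor39UpToTwist.lean`, ruling π3-1 of abc-iut-L3-lead) from the landed steps of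
the printed proof: (a) = (R1, every `θ`) `Hom.compat_of_chartPullbackWith_iso` (abc-iut-w4-d080) ≫ (R0′)
`isCompatiblyQuasiGeometric_of_compat` (abc-iut-w4-d083); (b)-existence = (R2′)
`quasiGeometricGraphDataCompat_of_compactInVerticial` (abc-iut-w4-d083) ≫ (R3, `∃ θ`)
`chartPullbackWith_iso_of_compatible` (abc-iut-w4-d064 `twistAbsorption_holds` + abc-iut-w4-d080) —
packaged def-free in `TemperedReconstructionCor39UpToTwistAssembly.lean`; (b)-uniqueness of the whole
underlying morphism of semi-graphs = (R1) ×2 + `base_eq_of_compatV` (abc-iut-w4-d083: vertex map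
abc-iut-L3-t2, branch maps by total estrangement, edge map from the branch maps — UNCONDITIONAL).  Net:
`cor39CompatUpToTwist_of_compactInVerticial : CompactInVerticial → Cor39CompatUpToTwist` — the single
remaining input is the named fact Thm. 3.7 (iii) `CompactInVerticial`.  Also the projections relating
the twin to the frozen readings.  Nothing here takes a side on [IUTchIII] Cor. 3.12; typed ≠ discharged.
-/

open CategoryTheory

namespace Literature.AnabelianGeometry.SemiGraphs

namespace ProfiniteSemiGraph

universe u

variable {𝒢 ℋ : ProfiniteSemiGraph.{u}}

namespace Hom

/-- Induced in the frozen v2 sense (chosen family) ⇒ induced up to twist.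
[cite: MochizukiSemiAnbd2006, Prop 3.6(iv) p.39] -/
theorem inducesUpToTwist_of_induces (F : Hom 𝒢 ℋ) (c𝒢 : TemperedPiChart 𝒢)
    (cℋ : TemperedPiChart ℋ) (φ : c𝒢.G →ₜ* cℋ.G) (h : F.Induces c𝒢 cℋ φ) :
    F.InducesUpToTwist c𝒢 cℋ φ :=
  ⟨F.chosenConjugators, h⟩

/-- (R1, up to twist) "induced up to twist" ⇒ "compatible up to conjugation with `F` on the verticial
and edge homomorphisms" ([SemiAnbd] p. 43 ll. 8–13, converse direction, for every family `θ`).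
[cite: MochizukiSemiAnbd2006, Cor 3.9 p.43] -/
theorem compat_of_inducesUpToTwist (F : Hom 𝒢 ℋ) (c𝒢 : TemperedPiChart 𝒢)
    (cℋ : TemperedPiChart ℋ) (φ : c𝒢.G →ₜ* cℋ.G) (h : F.InducesUpToTwist c𝒢 cℋ φ) :
    F.CompatV c𝒢 cℋ φ ∧ F.CompatE c𝒢 cℋ φ := by
  obtain ⟨θ, hθ⟩ := h
  exact F.compat_of_chartPullbackWith_iso θ c𝒢 cℋ φ hθ

/-- (R3, up to twist, modulo Thm. 3.7 (iii)) "compatible up to conjugation with a locally open `F`"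
⇒ "induced by `F` up to twist" ([SemiAnbd] p. 43 ll. 12–13). [cite: MochizukiSemiAnbd2006, Cor 3.9 p.43] -/
theorem inducesUpToTwist_of_compat (hCV : CompactInVerticial.{u}) (h𝒢 : Cor39Hypotheses 𝒢)
    (hℋ : Cor39Hypotheses ℋ) (c𝒢 : TemperedPiChart 𝒢) (cℋ : TemperedPiChart ℋ) (F : Hom 𝒢 ℋ)
    (φ : c𝒢.G →ₜ* cℋ.G) (hF : F.IsLocallyOpen) (hV : F.CompatV c𝒢 cℋ φ) (hE : F.CompatE c𝒢 cℋ φ) :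
    F.InducesUpToTwist c𝒢 cℋ φ :=
  chartPullbackWith_iso_of_compatible hCV h𝒢 hℋ c𝒢 cℋ F φ hF hV hE

/-- For a locally open `F` (and `G`, `H` as in Cor. 3.9, modulo Thm. 3.7 (iii)): "induced by `F` up to
twist" ⟺ "compatible up to conjugation with `F` on the verticial and edge homomorphisms".
[cite: MochizukiSemiAnbd2006, Cor 3.9 p.43] -/
theorem inducesUpToTwist_iff_compat (hCV : CompactInVerticial.{u}) (h𝒢 : Cor39Hypotheses 𝒢)
    (hℋ : Cor39Hypotheses ℋ) (c𝒢 : TemperedPiChart 𝒢) (cℋ : TemperedPiChart ℋ) (F : Hom 𝒢 ℋ)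
    (φ : c𝒢.G →ₜ* cℋ.G) (hF : F.IsLocallyOpen) :
    F.InducesUpToTwist c𝒢 cℋ φ ↔ F.CompatV c𝒢 cℋ φ ∧ F.CompatE c𝒢 cℋ φ :=
  ⟨F.compat_of_inducesUpToTwist c𝒢 cℋ φ,
    fun h => inducesUpToTwist_of_compat hCV h𝒢 hℋ c𝒢 cℋ F φ hF h.1 h.2⟩

end Hom

/-- **Cor. 3.9 (b), uniqueness of the underlying morphism of semi-graphs, UNCONDITIONAL**: two locally
open `F`, `F'` (with `G`, `H` as in Cor. 3.9) inducing the same `φ` up to twist have the same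
underlying `SemiGraph.Hom` (vertex, edge AND branch maps) — R1 (every `θ`) ×2, then abc-iut-w4-d083's
`base_eq_of_compatV` (vertex map abc-iut-L3-t2, branch maps by total estrangement, edge map from the
branch maps; Thm. 3.7 (i), (ii) are theorems of the tree, (iii) is NOT needed here).
[cite: MochizukiSemiAnbd2006, Cor 3.9 p.43] -/
theorem base_eq_of_inducesUpToTwist (h𝒢 : Cor39Hypotheses 𝒢) (hℋ : Cor39Hypotheses ℋ)
    (c𝒢 : TemperedPiChart 𝒢) (cℋ : TemperedPiChart ℋ) {F F' : Hom 𝒢 ℋ} {φ : c𝒢.G →ₜ* cℋ.G}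
    (hF : F.IsLocallyOpen) (hF' : F'.IsLocallyOpen) (hind : F.InducesUpToTwist c𝒢 cℋ φ)
    (hind' : F'.InducesUpToTwist c𝒢 cℋ φ) : F.base = F'.base :=
  base_eq_of_compatV h𝒢 hℋ c𝒢 cℋ hF hF' (F.compat_of_inducesUpToTwist c𝒢 cℋ φ hind).1
    (F'.compat_of_inducesUpToTwist c𝒢 cℋ φ hind').1

/-- **[SemiAnbd] Corollary 3.9 (compatible reading of Def. 3.8, "induced" up to the 2-cells of
Rmk. 2.4.2) MODULO Theorem 3.7 (iii) `CompactInVerticial` ALONE**, as the named twin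
`Cor39CompatUpToTwist`: (a) = R1 ≫ R0′; (b)-existence = R2′ ≫ R3 (these two use (iii));
(b)-uniqueness = `base_eq_of_inducesUpToTwist` (unconditional); Thm. 3.7 (i), (ii), (iv) bound to the
tree's theorems. [cite: MochizukiSemiAnbd2006, Cor 3.9 pp.42-43] -/
theorem cor39CompatUpToTwist_of_compactInVerticial (hCV : CompactInVerticial.{u}) :
    Cor39CompatUpToTwist.{u} := by
  intro 𝒢 ℋ h𝒢 hℋ c𝒢 cℋ
  refine ⟨fun F hF φ hind => ?_, fun φ hφ => ?_⟩
  · exact isCompatiblyQuasiGeometric_of_exists_chartPullbackWith_iso hCV h𝒢 hℋ c𝒢 cℋ F φ hF hind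
  · obtain ⟨F, hF, hind⟩ :=
      exists_hom_chartPullbackWith_iso_of_isCompatiblyQuasiGeometric hCV h𝒢 hℋ c𝒢 cℋ φ hφ
    exact ⟨F, hF, hind, fun F' hF' hind' =>
      (base_eq_of_inducesUpToTwist h𝒢 hℋ c𝒢 cℋ hF hF' hind hind').symm⟩

/-- The twin implies clause (a) of the frozen `Cor39` / `Cor39Compat` (chosen family, literal reading
of Def. 3.8). [cite: MochizukiSemiAnbd2006, Cor 3.9 p.42] -/
theorem cor39_a_of_cor39CompatUpToTwist (h : Cor39CompatUpToTwist.{u}) (h𝒢 : Cor39Hypotheses 𝒢)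
    (hℋ : Cor39Hypotheses ℋ) (c𝒢 : TemperedPiChart 𝒢) (cℋ : TemperedPiChart ℋ) (F : Hom 𝒢 ℋ)
    (hF : F.IsLocallyOpen) (φ : c𝒢.G →ₜ* cℋ.G) (hind : F.Induces c𝒢 cℋ φ) : IsQuasiGeometric φ :=
  ((h 𝒢 ℋ h𝒢 hℋ c𝒢 cℋ).1 F hF φ (F.inducesUpToTwist_of_induces c𝒢 cℋ φ hind)).isQuasiGeometric

/-- The twin implies the frozen `Cor39Compat` GIVEN the frozen (R3) `InducesOfCompatible` (needed only
to convert the existence clause back to the chosen family) — recorded to make the exact gap between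
the two readings explicit: it is (R3) for the CHOSEN family and nothing else.
[cite: MochizukiSemiAnbd2006, Cor 3.9 p.42] -/
theorem cor39Compat_of_cor39CompatUpToTwist (h : Cor39CompatUpToTwist.{u})
    (hR3 : InducesOfCompatible.{u}) : Cor39Compat.{u} := by
  intro 𝒢 ℋ h𝒢 hℋ c𝒢 cℋ
  refine ⟨fun F hF φ hind => cor39_a_of_cor39CompatUpToTwist h h𝒢 hℋ c𝒢 cℋ F hF φ hind,
    fun φ hφ => ?_⟩
  obtain ⟨F, hF, hind, huniq⟩ := (h 𝒢 ℋ h𝒢 hℋ c𝒢 cℋ).2 φ hφ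
  obtain ⟨hV, hE⟩ := F.compat_of_inducesUpToTwist c𝒢 cℋ φ hind
  refine ⟨F, hF, hR3 𝒢 ℋ h𝒢 hℋ c𝒢 cℋ F φ hF hV hE, fun F' hF' hind' => ?_⟩
  have hb : F'.base = F.base := huniq F' hF' (F'.inducesUpToTwist_of_induces c𝒢 cℋ φ hind')
  exact ⟨congrArg SemiGraph.Hom.vertexMap hb, congrArg SemiGraph.Hom.edgeMap hb⟩

end ProfiniteSemiGraph

end Literature.AnabelianGeometry.SemiGraphs
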